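import Summits.AtomisticToContinuum.Crystallization.Theses.ChessboardParticlePlanes
import Summits.AtomisticToContinuum.Crystallization.Theorems.ChessboardParticlePlanesLjPlaneChessboardCrossKernelFourier
import Summits.AtomisticToContinuum.Crystallization.Theorems.ChessboardParticlePlanesLjPlaneChessboardKernelEntry
import Summits.AtomisticToContinuum.Crystallization.Theorems.ChessboardParticlePlanesLjPlaneChessboardMatrixLatticeForm

/-!
# Crux `ChessboardParticlePlanes.LjPlaneChessboard` (stmt-AtomisticToContinuum-6709), line `Sketch`,
# stub `kernelEntry_fourier` — the planar Fourier transform of a kernel entry `k_{i₀ m}`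

The per-site chessboard deficit is a planar matrix-kernel lattice form whose entries are the series
`k_{i₀ m}(ρ) = Σ_{j ∈ ℤ} T(ρ, j)`, `T = A - B - C - D` (`kernelEntry_regular`): the cross-plane
terms `A = 2 K_ζ(ρ - jδ)`, `ζ = z i₀ - z (m + jn)` (off `m + jn = i₀`), the self-copy correction
`B = Σ'_{k ≠ 0} (K_{2|k|c}(ρ) + K_{2|k|c'}(ρ))` (on `m + jn = i₀`) and the partner-register
corrections `C = Σ'_k K_{|2k+1|c}(ρ - jδ)`, `D = Σ'_k K_{|2k+1|c'}(ρ - jδ)` (on `m + jn = i₀ ± 1`),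
with the cross-plane Lennard-Jones kernel `K_ζ(ρ) = V_LJ(√(‖ρ‖² + ζ²))` and the two gaps
`c, c' ≥ 3/4` at `i₀`.  CLAIM: Mathlib's Fourier transform of `k_{i₀ m}` (kernel `𝐞(-⟪ρ, w⟫)`) is
the termwise transform `Σ_j T̂(w, j)`, in which every shifted kernel `K_ζ(· - jδ)` becomes
`𝐞(-⟪jδ, w⟫) 𝓕K_{|ζ|}(w)` and every unshifted one `𝓕K_ζ(w)`, with the Laplace form
`𝓕K_ζ(w) = -2π ∫_{λ > 2π‖w‖} W(2π‖w‖, λ) e^{-λζ} dλ` of `fourier_ljCrossKernel`.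

PROOF.  The M-test majorants of `kernelEntry_regular` are uniform in `ρ`:
`|T(ρ, j)| ≤ u_j (1 + ‖ρ‖)⁻³` with `Σ u < ∞` (`kernelEntry_pieceA`, `kernelEntry_innerB`,
`kernelEntry_innerCD`), and `(1 + ‖ρ‖)⁻³` is integrable on the plane (`integrable_one_add_norm`,
`2 < 3`), so `Σ_j ∫ |T(·, j)| < ∞` and `𝓕` commutes with `Σ_j`
(`MeasureTheory.integral_tsum_of_summable_integral_norm`; the character has norm one) —
`kernelEntryF_fourier_tsum`.  Termwise, `𝓕` is linear on integrable functions
(`kernelEntryF_fourier_sub4`), translation becomes a phase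
(`matrixLatticeForm_fourier_translate`, `kernelEntryF_fourier_shift`; `ζ² = |ζ|²` and the
`A`-offset is non-zero by strict monotonicity of `z`), the correction series are exchanged with `𝓕`
by the same M-test in `k` (`kernelEntryF_innerB`, `kernelEntryF_innerCD`), and each kernel
transform is `fourier_ljCrossKernel`.  [folklore]  No definition is introduced.
-/

noncomputable section

namespace Summit.AtomisticToContinuum.Crystallization.Theorems.ChessboardParticlePlanesLjPlaneChessboard

open Literature.MathematicalPhysics.StatisticalMechanics MeasureTheory
open scoped Real InnerProductSpace FourierTransform

/-! ## Fourier-side bookkeeping on the plane -/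

/-- A continuous real function on the plane with cubic decay is integrable (as a complex
function): `(1 + ‖ρ‖)⁻³` is integrable in dimension `2 < 3` (`integrable_one_add_norm`).
[folklore] -/
theorem kernelEntryF_integrable {f : EuclideanSpace ℝ (Fin 2) → ℝ} {U : ℝ} (hf : Continuous f)
    (hU : ∀ ρ, |f ρ| ≤ U * (1 + ‖ρ‖) ^ (-(3 : ℝ))) :
    Integrable (fun ρ : EuclideanSpace ℝ (Fin 2) => ((f ρ : ℝ) : ℂ)) := by
  have hI : Integrable (fun ρ : EuclideanSpace ℝ (Fin 2) => (1 + ‖ρ‖) ^ (-(3 : ℝ))) :=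
    integrable_one_add_norm (by rw [finrank_euclideanSpace_fin]; norm_num)
  refine Integrable.mono' (hI.const_mul U) (Complex.continuous_ofReal.comp hf).aestronglyMeasurable
    (Filter.Eventually.of_forall fun ρ => ?_)
  rw [Complex.norm_real, Real.norm_eq_abs]
  exact hU ρ

/-- The Fourier transform of the zero function vanishes. [folklore] -/
theorem kernelEntryF_fourier_zero (w : EuclideanSpace ℝ (Fin 2)) :
    𝓕 (fun _ : EuclideanSpace ℝ (Fin 2) => (0 : ℂ)) w = 0 := by
  simp [Real.fourier_eq]

/-- `𝓕[2f] = 2 𝓕[f]` for a real `f` viewed as a complex function. [folklore] -/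
theorem kernelEntryF_fourier_two_mul (f : EuclideanSpace ℝ (Fin 2) → ℝ)
    (w : EuclideanSpace ℝ (Fin 2)) :
    𝓕 (fun v : EuclideanSpace ℝ (Fin 2) => ((2 * f v : ℝ) : ℂ)) w =
      2 * 𝓕 (fun v : EuclideanSpace ℝ (Fin 2) => ((f v : ℝ) : ℂ)) w := by
  rw [Real.fourier_eq, Real.fourier_eq, ← integral_const_mul]
  refine integral_congr_ae (Filter.Eventually.of_forall fun v => ?_)
  simp only [Circle.smul_def, smul_eq_mul]
  push_cast
  ring

/-- Additivity `𝓕[f + g] = 𝓕[f] + 𝓕[g]` for integrable real `f, g` viewed as complex functions.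
[folklore] -/
theorem kernelEntryF_fourier_add {f g : EuclideanSpace ℝ (Fin 2) → ℝ}
    (hf : Integrable (fun v : EuclideanSpace ℝ (Fin 2) => ((f v : ℝ) : ℂ)))
    (hg : Integrable (fun v : EuclideanSpace ℝ (Fin 2) => ((g v : ℝ) : ℂ)))
    (w : EuclideanSpace ℝ (Fin 2)) :
    𝓕 (fun v : EuclideanSpace ℝ (Fin 2) => ((f v + g v : ℝ) : ℂ)) w =
      𝓕 (fun v : EuclideanSpace ℝ (Fin 2) => ((f v : ℝ) : ℂ)) w +
        𝓕 (fun v : EuclideanSpace ℝ (Fin 2) => ((g v : ℝ) : ℂ)) w := by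
  rw [Real.fourier_eq, Real.fourier_eq, Real.fourier_eq, ← integral_add
    ((Real.fourierIntegral_convergent_iff w).2 hf) ((Real.fourierIntegral_convergent_iff w).2 hg)]
  refine integral_congr_ae (Filter.Eventually.of_forall fun v => ?_)
  simp only [Complex.ofReal_add, smul_add]

/-- Linearity `𝓕[a - b - c - d] = 𝓕[a] - 𝓕[b] - 𝓕[c] - 𝓕[d]` for integrable real `a, b, c, d`
viewed as complex functions. [folklore] -/
theorem kernelEntryF_fourier_sub4 {a b c d : EuclideanSpace ℝ (Fin 2) → ℝ}
    (ha : Integrable (fun v : EuclideanSpace ℝ (Fin 2) => ((a v : ℝ) : ℂ)))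
    (hb : Integrable (fun v : EuclideanSpace ℝ (Fin 2) => ((b v : ℝ) : ℂ)))
    (hc : Integrable (fun v : EuclideanSpace ℝ (Fin 2) => ((c v : ℝ) : ℂ)))
    (hd : Integrable (fun v : EuclideanSpace ℝ (Fin 2) => ((d v : ℝ) : ℂ)))
    (w : EuclideanSpace ℝ (Fin 2)) :
    𝓕 (fun v : EuclideanSpace ℝ (Fin 2) => ((a v - b v - c v - d v : ℝ) : ℂ)) w =
      𝓕 (fun v : EuclideanSpace ℝ (Fin 2) => ((a v : ℝ) : ℂ)) w -
        𝓕 (fun v : EuclideanSpace ℝ (Fin 2) => ((b v : ℝ) : ℂ)) w -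
        𝓕 (fun v : EuclideanSpace ℝ (Fin 2) => ((c v : ℝ) : ℂ)) w -
        𝓕 (fun v : EuclideanSpace ℝ (Fin 2) => ((d v : ℝ) : ℂ)) w := by
  have ha' := (Real.fourierIntegral_convergent_iff w).2 ha
  have hb' := (Real.fourierIntegral_convergent_iff w).2 hb
  have hc' := (Real.fourierIntegral_convergent_iff w).2 hc
  have hd' := (Real.fourierIntegral_convergent_iff w).2 hd
  have hab : Integrable (fun v : EuclideanSpace ℝ (Fin 2) =>
      𝐞 (-⟪v, w⟫_ℝ) • ((a v : ℝ) : ℂ) - 𝐞 (-⟪v, w⟫_ℝ) • ((b v : ℝ) : ℂ)) := ha'.sub hb'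
  have habc : Integrable (fun v : EuclideanSpace ℝ (Fin 2) =>
      𝐞 (-⟪v, w⟫_ℝ) • ((a v : ℝ) : ℂ) - 𝐞 (-⟪v, w⟫_ℝ) • ((b v : ℝ) : ℂ) -
        𝐞 (-⟪v, w⟫_ℝ) • ((c v : ℝ) : ℂ)) := hab.sub hc'
  simp only [Real.fourier_eq]
  rw [← integral_sub ha' hb', ← integral_sub hab hc', ← integral_sub habc hd']
  refine integral_congr_ae (Filter.Eventually.of_forall fun v => ?_)
  simp only [Complex.ofReal_sub, smul_sub]

/-- **Exchange of `𝓕` and a series under the M-test**: if `g i` are continuous with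
`|g i ρ| ≤ u i (1 + ‖ρ‖)⁻³` and `Σ u < ∞`, then `𝓕[Σ'_i g i] = Σ'_i 𝓕[g i]` pointwise
(`MeasureTheory.integral_tsum_of_summable_integral_norm`; the character has norm one). [folklore] -/
theorem kernelEntryF_fourier_tsum {ι : Type*} [Countable ι] {g : ι → EuclideanSpace ℝ (Fin 2) → ℝ}
    {u : ι → ℝ} (hg : ∀ i, Continuous (g i)) (hu : Summable u)
    (hle : ∀ i ρ, |g i ρ| ≤ u i * (1 + ‖ρ‖) ^ (-(3 : ℝ))) (w : EuclideanSpace ℝ (Fin 2)) :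
    𝓕 (fun ρ : EuclideanSpace ℝ (Fin 2) => (((∑' i, g i ρ) : ℝ) : ℂ)) w =
      ∑' i, 𝓕 (fun ρ : EuclideanSpace ℝ (Fin 2) => ((g i ρ : ℝ) : ℂ)) w := by
  have hI : Integrable (fun ρ : EuclideanSpace ℝ (Fin 2) => (1 + ‖ρ‖) ^ (-(3 : ℝ))) :=
    integrable_one_add_norm (by rw [finrank_euclideanSpace_fin]; norm_num)
  have hint : ∀ i, Integrable (fun ρ : EuclideanSpace ℝ (Fin 2) => ((g i ρ : ℝ) : ℂ)) :=
    fun i => kernelEntryF_integrable (hg i) (hle i)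
  simp only [Real.fourier_eq]
  have h1 : ∀ v : EuclideanSpace ℝ (Fin 2),
      𝐞 (-⟪v, w⟫_ℝ) • (((∑' i, g i v) : ℝ) : ℂ) = ∑' i, 𝐞 (-⟪v, w⟫_ℝ) • ((g i v : ℝ) : ℂ) := by
    intro v
    rw [Complex.ofReal_tsum]
    simp only [Circle.smul_def, smul_eq_mul]
    exact tsum_mul_left.symm
  simp_rw [h1]
  refine (integral_tsum_of_summable_integral_norm
    (fun i => (Real.fourierIntegral_convergent_iff w).2 (hint i)) ?_).symm
  simp_rw [Circle.norm_smul, Complex.norm_real, Real.norm_eq_abs]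
  refine Summable.of_nonneg_of_le (fun i => integral_nonneg fun ρ => abs_nonneg _) (fun i => ?_)
    (hu.mul_right (∫ ρ : EuclideanSpace ℝ (Fin 2), (1 + ‖ρ‖) ^ (-(3 : ℝ))))
  rw [← integral_const_mul]
  exact integral_mono_of_nonneg (Filter.Eventually.of_forall fun ρ => abs_nonneg _)
    (hI.const_mul _) (Filter.Eventually.of_forall fun ρ => hle i ρ)

/-- **One shifted cross-plane kernel**: for `ζ ≠ 0` and a shift `v₀`, the kernel
`ρ ↦ V_LJ(√(‖ρ - v₀‖² + ζ²))` is integrable and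
`𝓕[V_LJ(√(‖· - v₀‖² + ζ²))](w) = 𝐞(-⟪v₀, w⟫) 𝓕[K_{|ζ|}](w)` with the Laplace form of
`fourier_ljCrossKernel` (`ζ² = |ζ|²`, `matrixLatticeForm_fourier_translate`). [folklore] -/
theorem kernelEntryF_fourier_shift (v₀ w : EuclideanSpace ℝ (Fin 2)) {ζ : ℝ} (hζ : ζ ≠ 0) :
    Integrable (fun ρ : EuclideanSpace ℝ (Fin 2) =>
      ((lennardJones (Real.sqrt (‖ρ - v₀‖ ^ 2 + ζ ^ 2)) : ℝ) : ℂ)) ∧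
    𝓕 (fun ρ : EuclideanSpace ℝ (Fin 2) =>
      ((lennardJones (Real.sqrt (‖ρ - v₀‖ ^ 2 + ζ ^ 2)) : ℝ) : ℂ)) w =
      𝐞 (-⟪v₀, w⟫_ℝ) • ((-(2 * π) *
        ∫ l in Set.Ioi (2 * π * ‖w‖),
          ((l ^ 2 - (2 * π * ‖w‖) ^ 2) * Real.sqrt (l ^ 2 - (2 * π * ‖w‖) ^ 2) / 144
            - (l ^ 2 - (2 * π * ‖w‖) ^ 2) ^ 4 * Real.sqrt (l ^ 2 - (2 * π * ‖w‖) ^ 2)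
                / 43545600) * Real.exp (-(l * |ζ|)) : ℝ) : ℂ) := by
  obtain ⟨hint, hF⟩ := fourier_ljCrossKernel (EuclideanSpace ℝ (Fin 2)) finrank_euclideanSpace_fin
    |ζ| w (abs_pos.2 hζ)
  have key := matrixLatticeForm_fourier_translate (fun v : EuclideanSpace ℝ (Fin 2) =>
    ((lennardJones (Real.sqrt (‖v‖ ^ 2 + |ζ| ^ 2)) : ℝ) : ℂ)) (-v₀) w
  rw [inner_neg_left, hF] at key
  have hfun : (fun ρ : EuclideanSpace ℝ (Fin 2) =>
      ((lennardJones (Real.sqrt (‖ρ - v₀‖ ^ 2 + ζ ^ 2)) : ℝ) : ℂ)) =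
      fun ρ => (fun v : EuclideanSpace ℝ (Fin 2) =>
        ((lennardJones (Real.sqrt (‖v‖ ^ 2 + |ζ| ^ 2)) : ℝ) : ℂ)) (-v₀ + ρ) := by
    funext ρ
    simp only [neg_add_eq_sub, sq_abs]
  rw [hfun]
  exact ⟨hint.comp_add_left (-v₀), key⟩

/-! ## The correction series on the Fourier side -/

/-- **Self-copy correction on the Fourier side**: for `c, c' ≥ 3/4`,
`𝓕[Σ'_{k ≠ 0} (K_{2|k|c} + K_{2|k|c'})](w) = Σ'_{k ≠ 0} (𝓕K_{2|k|c}(w) + 𝓕K_{2|k|c'}(w))` with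
`K_ζ(ρ) = V_LJ(√(‖ρ‖² + ζ²))`: the M-test majorants `K |2|k|c|⁻³ ≲ |k|⁻³` of
`kernelEntry_term_bound` make `Σ_k ∫ |K_{2|k|c}| < ∞` (`kernelEntryF_fourier_tsum`), and each
term is given by `fourier_ljCrossKernel` (`2|k|c > 0`). [folklore] -/
theorem kernelEntryF_innerB {c c' : ℝ} (hc : 3 / 4 ≤ c) (hc' : 3 / 4 ≤ c')
    (w : EuclideanSpace ℝ (Fin 2)) :
    𝓕 (fun ρ : EuclideanSpace ℝ (Fin 2) => ((∑' k : {k : ℤ // k ≠ 0},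
        (lennardJones (Real.sqrt (‖ρ‖ ^ 2 + (2 * |(k : ℝ)| * c) ^ 2)) +
         lennardJones (Real.sqrt (‖ρ‖ ^ 2 + (2 * |(k : ℝ)| * c') ^ 2))) : ℝ) : ℂ)) w =
      ∑' k : {k : ℤ // k ≠ 0},
        ((((-(2 * π) * ∫ l in Set.Ioi (2 * π * ‖w‖),
          ((l ^ 2 - (2 * π * ‖w‖) ^ 2) * Real.sqrt (l ^ 2 - (2 * π * ‖w‖) ^ 2) / 144
            - (l ^ 2 - (2 * π * ‖w‖) ^ 2) ^ 4 * Real.sqrt (l ^ 2 - (2 * π * ‖w‖) ^ 2)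
                / 43545600) * Real.exp (-(l * (2 * |(k : ℝ)| * c))) : ℝ) : ℂ)) +
        (((-(2 * π) * ∫ l in Set.Ioi (2 * π * ‖w‖),
          ((l ^ 2 - (2 * π * ‖w‖) ^ 2) * Real.sqrt (l ^ 2 - (2 * π * ‖w‖) ^ 2) / 144
            - (l ^ 2 - (2 * π * ‖w‖) ^ 2) ^ 4 * Real.sqrt (l ^ 2 - (2 * π * ‖w‖) ^ 2)
                / 43545600) * Real.exp (-(l * (2 * |(k : ℝ)| * c'))) : ℝ) : ℂ))) := by
  obtain ⟨K, hK0, hK⟩ := kernelEntry_term_bound (M := 0) le_rfl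
  have hk1 : ∀ k : {k : ℤ // k ≠ 0}, (1 : ℝ) ≤ |(k : ℝ)| := fun k => by
    exact_mod_cast Int.one_le_abs k.2
  have hpos : ∀ (k : {k : ℤ // k ≠ 0}) {d : ℝ}, 3 / 4 ≤ d → 0 < 2 * |(k : ℝ)| * d :=
    fun k d hd => by nlinarith [hk1 k]
  have hb' : ∀ (k : {k : ℤ // k ≠ 0}) {d : ℝ}, 3 / 4 ≤ d → |(k : ℝ)| ≤ |2 * |(k : ℝ)| * d| :=
    fun k d hd => by
      rw [abs_of_pos (hpos k hd)]
      nlinarith [hk1 k]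
  have hb : ∀ (k : {k : ℤ // k ≠ 0}) {d : ℝ}, 3 / 4 ≤ d → 3 / 4 ≤ |2 * |(k : ℝ)| * d| :=
    fun k d hd => by linarith [hk1 k, hb' k hd]
  have hinv : ∀ (k : {k : ℤ // k ≠ 0}) {d : ℝ}, 3 / 4 ≤ d →
      |2 * |(k : ℝ)| * d|⁻¹ ^ 3 ≤ |(k : ℝ)|⁻¹ ^ 3 := fun k d hd =>
    pow_le_pow_left₀ (inv_nonneg.2 (abs_nonneg _)) (inv_anti₀ (by linarith [hk1 k]) (hb' k hd)) 3
  have hle : ∀ (k : {k : ℤ // k ≠ 0}) {d : ℝ}, 3 / 4 ≤ d → ∀ ρ : EuclideanSpace ℝ (Fin 2),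
      |lennardJones (Real.sqrt (‖ρ‖ ^ 2 + (2 * |(k : ℝ)| * d) ^ 2))| ≤
        K * |2 * |(k : ℝ)| * d|⁻¹ ^ 3 * (1 + ‖ρ‖) ^ (-(3 : ℝ)) := fun k d hd ρ => by
    have h := hK 0 (2 * |(k : ℝ)| * d) ρ (hb k hd) (by simp)
    rwa [sub_zero] at h
  have hF := fun (k : {k : ℤ // k ≠ 0}) {d : ℝ} (hd : 3 / 4 ≤ d) =>
    fourier_ljCrossKernel (EuclideanSpace ℝ (Fin 2)) finrank_euclideanSpace_fin _ w (hpos k hd)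
  refine (kernelEntryF_fourier_tsum
    (u := fun k : {k : ℤ // k ≠ 0} => K * (|2 * |(k : ℝ)| * c|⁻¹ ^ 3 + |2 * |(k : ℝ)| * c'|⁻¹ ^ 3))
    ?_ ?_ ?_ w).trans
    (tsum_congr fun k => ?_)
  · intro k
    have h1 := kernelEntry_term_continuous 0 (hpos k hc).ne'
    have h2 := kernelEntry_term_continuous 0 (hpos k hc').ne'
    simp only [sub_zero] at h1 h2
    exact h1.add h2
  · refine Summable.of_nonneg_of_le (fun k => by positivity) (fun k => ?_)
      (((kernelEntry_summable_inv_cube.subtype _).add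
        (kernelEntry_summable_inv_cube.subtype _)).mul_left K)
    simp only [Function.comp_apply]
    exact mul_le_mul_of_nonneg_left (add_le_add (hinv k hc) (hinv k hc')) hK0
  · intro k ρ
    refine (abs_add_le _ _).trans ?_
    nlinarith [hle k hc ρ, hle k hc' ρ]
  · rw [kernelEntryF_fourier_add (hF k hc).1 (hF k hc').1, (hF k hc).2, (hF k hc').2]

/-- **Partner-register correction on the Fourier side**: for `d ≥ 3/4` and a shift `v₀`,
`𝓕[Σ'_k K_{|2k+1|d}(· - v₀)](w) = 𝐞(-⟪v₀, w⟫) Σ'_k 𝓕K_{|2k+1|d}(w)`: M-test majorants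
`K |(2k+1)d|⁻³` (`kernelEntry_term_bound`, `Σ_k |2k+1|⁻³ < ∞`), `kernelEntryF_fourier_tsum`, and
`kernelEntryF_fourier_shift` termwise. [folklore] -/
theorem kernelEntryF_innerCD (v₀ w : EuclideanSpace ℝ (Fin 2)) {d : ℝ} (hd : 3 / 4 ≤ d) :
    𝓕 (fun ρ : EuclideanSpace ℝ (Fin 2) => ((∑' k : ℤ,
        lennardJones (Real.sqrt (‖ρ - v₀‖ ^ 2 + (|2 * (k : ℝ) + 1| * d) ^ 2)) : ℝ) : ℂ)) w =
      𝐞 (-⟪v₀, w⟫_ℝ) • ∑' k : ℤ,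
        (((-(2 * π) * ∫ l in Set.Ioi (2 * π * ‖w‖),
          ((l ^ 2 - (2 * π * ‖w‖) ^ 2) * Real.sqrt (l ^ 2 - (2 * π * ‖w‖) ^ 2) / 144
            - (l ^ 2 - (2 * π * ‖w‖) ^ 2) ^ 4 * Real.sqrt (l ^ 2 - (2 * π * ‖w‖) ^ 2)
                / 43545600) * Real.exp (-(l * (|2 * (k : ℝ) + 1| * d))) : ℝ) : ℂ)) := by
  obtain ⟨K, hK0, hK⟩ := kernelEntry_term_bound (M := 4 / 3 * ‖v₀‖) (by positivity)
  have hk1 : ∀ k : ℤ, (1 : ℝ) ≤ |2 * (k : ℝ) + 1| := fun k => by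
    exact_mod_cast (Int.one_le_abs (by omega) : (1 : ℤ) ≤ |2 * k + 1|)
  have hpos : ∀ k : ℤ, 0 < |2 * (k : ℝ) + 1| * d := fun k => by nlinarith [hk1 k]
  have hb' : ∀ k : ℤ, 3 / 4 * |2 * (k : ℝ) + 1| ≤ |(|2 * (k : ℝ) + 1| * d)| := fun k => by
    rw [abs_of_pos (hpos k)]
    nlinarith [hk1 k]
  have hb : ∀ k : ℤ, 3 / 4 ≤ |(|2 * (k : ℝ) + 1| * d)| := fun k => by nlinarith [hk1 k, hb' k]
  have hv : ∀ k : ℤ, ‖v₀‖ ≤ 4 / 3 * ‖v₀‖ * |(|2 * (k : ℝ) + 1| * d)| := fun k => by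
    nlinarith [norm_nonneg v₀, hb k]
  have hinv : ∀ k : ℤ, |(|2 * (k : ℝ) + 1| * d)|⁻¹ ^ 3 ≤
      (4 / 3) ^ 3 * |((2 * k + 1 : ℤ) : ℝ)|⁻¹ ^ 3 := fun k => by
    refine (pow_le_pow_left₀ (inv_nonneg.2 (abs_nonneg _))
      (inv_anti₀ (by linarith [hk1 k]) (hb' k)) 3).trans (le_of_eq ?_)
    push_cast
    rw [mul_inv, mul_pow]
    norm_num
  have hinj : Function.Injective fun k : ℤ => 2 * k + 1 := fun k k' h => by simp only at h; omega
  refine (kernelEntryF_fourier_tsum (u := fun k : ℤ => K * |(|2 * (k : ℝ) + 1| * d)|⁻¹ ^ 3)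
    (fun k => kernelEntry_term_continuous v₀ (hpos k).ne') ?_
    (fun k ρ => hK v₀ _ ρ (hb k) (hv k)) w).trans ?_
  · refine Summable.of_nonneg_of_le (fun k => by positivity) (fun k => ?_)
      (((kernelEntry_summable_inv_cube.comp_injective hinj).mul_left ((4 / 3) ^ 3)).mul_left K)
    simp only [Function.comp_apply]
    exact mul_le_mul_of_nonneg_left (hinv k) hK0
  · rw [← tsum_const_smul' (𝐞 (-⟪v₀, w⟫_ℝ))]
    refine tsum_congr fun k => ?_
    rw [(kernelEntryF_fourier_shift v₀ w (hpos k).ne').2, abs_of_pos (hpos k)]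

/-! ## The registered stub -/

/-- **K2 — the planar Fourier transform of a kernel entry.**  With the data of
`kernelEntry_regular` (a `3/4`-gapped strictly increasing height sequence `z`, a planar shift `δ`,
`i₀, m < n`), the entry `f(ρ) = Σ'_j T(ρ, j)`, `T = A - B - C - D`, has Fourier transform
`𝓕[f](w) = Σ'_j T̂(w, j)`, where every cross-plane kernel `V_LJ(√(‖ρ - jδ‖² + ζ²))` is replaced by
`𝐞(-⟪jδ, w⟫) 𝓕K_{|ζ|}(w)` in the Laplace form of `fourier_ljCrossKernel` and the unshifted
self-copy kernels by `𝓕K_ζ(w)`.  Proof: the `ρ`-uniform summable majorants of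
`kernelEntry_regular` (`kernelEntry_pieceA`, `kernelEntry_innerB`, `kernelEntry_innerCD`) allow the
exchange of `𝓕` with `Σ_j` (`kernelEntryF_fourier_tsum`); termwise, linearity
(`kernelEntryF_fourier_sub4`), the shift rule (`kernelEntryF_fourier_shift`; the `A`-offset
`z i₀ - z (m + jn)` is non-zero by strict monotonicity) and the correction series
(`kernelEntryF_innerB`, `kernelEntryF_innerCD`) match the four `if`-branches. [folklore] -/
theorem kernelEntry_fourier :
    ∀ (z : ℤ → ℝ) (n : ℕ) (δ : EuclideanSpace ℝ (Fin 2)) (c₀ : ℝ) (i₀ m : ℕ),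
      0 < n → StrictMono z → (∀ i : ℤ, (3 : ℝ) / 4 ≤ z (i + 1) - z i) → 0 < c₀ →
      (∀ i : ℤ, z (i + n) = z i + c₀) → i₀ < n → m < n →
      ∀ w : EuclideanSpace ℝ (Fin 2),
      𝓕 (fun ρ : EuclideanSpace ℝ (Fin 2) => ((∑' j : ℤ,
        ((if (m : ℤ) + j * n = (i₀ : ℤ) then 0 else
            2 * lennardJones (Real.sqrt (‖ρ - (j : ℝ) • δ‖ ^ 2 + (z (i₀ : ℤ) - z ((m : ℤ) + j * n)) ^ 2)))
          - (if (m : ℤ) + j * n = (i₀ : ℤ) then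
              ∑' k : {k : ℤ // k ≠ 0},
                (lennardJones (Real.sqrt (‖ρ‖ ^ 2 + (2 * |(k : ℝ)| * (z ((i₀ : ℤ) + 1) - z (i₀ : ℤ))) ^ 2)) +
                 lennardJones (Real.sqrt (‖ρ‖ ^ 2 + (2 * |(k : ℝ)| * (z (i₀ : ℤ) - z ((i₀ : ℤ) - 1))) ^ 2)))
             else 0)
          - (if (m : ℤ) + j * n = (i₀ : ℤ) + 1 then
              ∑' k : ℤ, lennardJones (Real.sqrt (‖ρ - (j : ℝ) • δ‖ ^ 2
                + (|2 * (k : ℝ) + 1| * (z ((i₀ : ℤ) + 1) - z (i₀ : ℤ))) ^ 2))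
             else 0)
          - (if (m : ℤ) + j * n = (i₀ : ℤ) - 1 then
              ∑' k : ℤ, lennardJones (Real.sqrt (‖ρ - (j : ℝ) • δ‖ ^ 2
                + (|2 * (k : ℝ) + 1| * (z (i₀ : ℤ) - z ((i₀ : ℤ) - 1))) ^ 2))
             else 0)) : ℝ) : ℂ)) w =
      ∑' j : ℤ,
        ((if (m : ℤ) + j * n = (i₀ : ℤ) then 0 else
            2 * (𝐞 (-⟪(j : ℝ) • δ, w⟫_ℝ) • (((-(2 * π) * ∫ l in Set.Ioi (2 * π * ‖w‖), ((l ^ 2 - (2 * π * ‖w‖) ^ 2) * Real.sqrt (l ^ 2 - (2 * π * ‖w‖) ^ 2) / 144 - (l ^ 2 - (2 * π * ‖w‖) ^ 2) ^ 4 * Real.sqrt (l ^ 2 - (2 * π * ‖w‖) ^ 2) / 43545600) * Real.exp (-(l * |z (i₀ : ℤ) - z ((m : ℤ) + j * n)|)) : ℝ) : ℂ))))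
          - (if (m : ℤ) + j * n = (i₀ : ℤ) then
              ∑' k : {k : ℤ // k ≠ 0}, ((((-(2 * π) * ∫ l in Set.Ioi (2 * π * ‖w‖), ((l ^ 2 - (2 * π * ‖w‖) ^ 2) * Real.sqrt (l ^ 2 - (2 * π * ‖w‖) ^ 2) / 144 - (l ^ 2 - (2 * π * ‖w‖) ^ 2) ^ 4 * Real.sqrt (l ^ 2 - (2 * π * ‖w‖) ^ 2) / 43545600) * Real.exp (-(l * (2 * |(k : ℝ)| * (z ((i₀ : ℤ) + 1) - z (i₀ : ℤ))))) : ℝ) : ℂ)) + (((-(2 * π) * ∫ l in Set.Ioi (2 * π * ‖w‖), ((l ^ 2 - (2 * π * ‖w‖) ^ 2) * Real.sqrt (l ^ 2 - (2 * π * ‖w‖) ^ 2) / 144 - (l ^ 2 - (2 * π * ‖w‖) ^ 2) ^ 4 * Real.sqrt (l ^ 2 - (2 * π * ‖w‖) ^ 2) / 43545600) * Real.exp (-(l * (2 * |(k : ℝ)| * (z (i₀ : ℤ) - z ((i₀ : ℤ) - 1))))) : ℝ) : ℂ)))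
             else 0)
          - (if (m : ℤ) + j * n = (i₀ : ℤ) + 1 then
              𝐞 (-⟪(j : ℝ) • δ, w⟫_ℝ) • ∑' k : ℤ, (((-(2 * π) * ∫ l in Set.Ioi (2 * π * ‖w‖), ((l ^ 2 - (2 * π * ‖w‖) ^ 2) * Real.sqrt (l ^ 2 - (2 * π * ‖w‖) ^ 2) / 144 - (l ^ 2 - (2 * π * ‖w‖) ^ 2) ^ 4 * Real.sqrt (l ^ 2 - (2 * π * ‖w‖) ^ 2) / 43545600) * Real.exp (-(l * (|2 * (k : ℝ) + 1| * (z ((i₀ : ℤ) + 1) - z (i₀ : ℤ))))) : ℝ) : ℂ))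
             else 0)
          - (if (m : ℤ) + j * n = (i₀ : ℤ) - 1 then
              𝐞 (-⟪(j : ℝ) • δ, w⟫_ℝ) • ∑' k : ℤ, (((-(2 * π) * ∫ l in Set.Ioi (2 * π * ‖w‖), ((l ^ 2 - (2 * π * ‖w‖) ^ 2) * Real.sqrt (l ^ 2 - (2 * π * ‖w‖) ^ 2) / 144 - (l ^ 2 - (2 * π * ‖w‖) ^ 2) ^ 4 * Real.sqrt (l ^ 2 - (2 * π * ‖w‖) ^ 2) / 43545600) * Real.exp (-(l * (|2 * (k : ℝ) + 1| * (z (i₀ : ℤ) - z ((i₀ : ℤ) - 1))))) : ℝ) : ℂ))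
             else 0)) := by
  intro z n δ c₀ i₀ m hn hz hgap _hc₀ _hper hi₀ hm w
  have hc : (3 : ℝ) / 4 ≤ z ((i₀ : ℤ) + 1) - z (i₀ : ℤ) := hgap _
  have hc' : (3 : ℝ) / 4 ≤ z (i₀ : ℤ) - z ((i₀ : ℤ) - 1) := by simpa using hgap ((i₀ : ℤ) - 1)
  -- the `ρ`-uniform summable majorants of `kernelEntry_regular`
  obtain ⟨uA, hA, hA'⟩ := kernelEntry_pieceA z n δ i₀ m hgap hi₀ hm
  obtain ⟨hUB, UB, hUB'⟩ := kernelEntry_innerB hc hc'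
  choose UC hUC using fun j : ℤ => (kernelEntry_innerCD ((j : ℝ) • δ) hc).2
  choose UD hUD using fun j : ℤ => (kernelEntry_innerCD ((j : ℝ) • δ) hc').2
  have hB := fun j : ℤ => kernelEntry_ite_piece (P := (m : ℤ) + j * n = (i₀ : ℤ)) hUB hUB'
  have hC := fun j : ℤ => kernelEntry_ite_piece (P := (m : ℤ) + j * n = (i₀ : ℤ) + 1)
    (kernelEntry_innerCD ((j : ℝ) • δ) hc).1 (hUC j)
  have hD := fun j : ℤ => kernelEntry_ite_piece (P := (m : ℤ) + j * n = (i₀ : ℤ) - 1)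
    (kernelEntry_innerCD ((j : ℝ) • δ) hc').1 (hUD j)
  -- Step 1: exchange `𝓕` and `Σ_j`
  refine (kernelEntryF_fourier_tsum
    (u := fun j => uA j + (if (m : ℤ) + j * n = (i₀ : ℤ) then UB else 0) +
      (if (m : ℤ) + j * n = (i₀ : ℤ) + 1 then UC j else 0) +
      (if (m : ℤ) + j * n = (i₀ : ℤ) - 1 then UD j else 0)) ?_ ?_ ?_ w).trans ?_
  · exact fun j => (((hA' j).1.sub (hB j).1).sub (hC j).1).sub (hD j).1
  · exact ((hA.add (kernelEntry_ite_summable hn _ _ _)).add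
      (kernelEntry_ite_summable hn _ _ _)).add (kernelEntry_ite_summable hn _ _ _)
  · intro j ρ
    refine (kernelEntry_abs_sub4_le _ _ _ _).trans ?_
    linarith [(hA' j).2 ρ, (hB j).2 ρ, (hC j).2 ρ, (hD j).2 ρ]
  -- Step 2: the transform of `T(·, j)`, branch by branch
  refine tsum_congr fun j => ?_
  rw [kernelEntryF_fourier_sub4 (kernelEntryF_integrable (hA' j).1 (hA' j).2)
    (kernelEntryF_integrable (hB j).1 (hB j).2) (kernelEntryF_integrable (hC j).1 (hC j).2)
    (kernelEntryF_integrable (hD j).1 (hD j).2)]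
  have hζ : (m : ℤ) + j * n ≠ i₀ → z (i₀ : ℤ) - z ((m : ℤ) + j * n) ≠ 0 := fun h =>
    sub_ne_zero.2 fun h' => h (hz.injective h').symm
  congr 1
  · congr 1
    · congr 1
      · by_cases h : (m : ℤ) + j * n = i₀
        · simp only [if_pos h, Complex.ofReal_zero, kernelEntryF_fourier_zero]
        · simp only [if_neg h]
          rw [kernelEntryF_fourier_two_mul, (kernelEntryF_fourier_shift _ w (hζ h)).2]
      · by_cases h : (m : ℤ) + j * n = i₀
        · simp only [if_pos h]
          exact kernelEntryF_innerB hc hc' w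
        · simp only [if_neg h, Complex.ofReal_zero, kernelEntryF_fourier_zero]
    · by_cases h : (m : ℤ) + j * n = i₀ + 1
      · simp only [if_pos h]
        exact kernelEntryF_innerCD _ w hc
      · simp only [if_neg h, Complex.ofReal_zero, kernelEntryF_fourier_zero]
  · by_cases h : (m : ℤ) + j * n = i₀ - 1
    · simp only [if_pos h]
      exact kernelEntryF_innerCD _ w hc'
    · simp only [if_neg h, Complex.ofReal_zero, kernelEntryF_fourier_zero]

end Summit.AtomisticToContinuum.Crystallization.Theorems.ChessboardParticlePlanesLjPlaneChessboard

end
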